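/-
Copyright (c) 2026 the pub-hodgecm-mathlib formalisation cell (harness21).  Prover seat hodgecm-mathlib-LH4-p08 (g9), req620 Track A «(D-RAM) FOUR-FRAME» squad, helper lane
on h413 = stmt-HodgeConjecture-24833 (count-neutral).  STAGE-1b, row (2), RamM lane of the (LAW) END — (R5b), the regime-B identity of the FLIPPED class.  2026-09-04.
-/
import Summits.HodgeConjecture.HodgeConjecture.Theorems.F0P3cDyRamToricCensusSumRamMFlip     -- ★ p859880 (LH4-p11 (g7)): T5s♭-RamM `toricCensusSum_ramM_flip`, `far_identity_flip`; brings ★ RamM∕RamK parts, ★ Unr blocks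
import Summits.HodgeConjecture.HodgeConjecture.Theorems.F0P3cDyRamToricCensusSumRamMCutoff   -- ★ p859810 (LH4-p04 (g7)): `sum_cut_part_eq_ramM` (the cut band, parity-free)
import HarnessLib

/-!
# Crux `H413`, line LH4 «(D-RAM) FOUR-FRAME» — STAGE-1b, row (2): T5s♭-RamM **EDITION 2** «THE FLIPPED CLASS UNDER THE WINDOW-PARITY LETTER, AND ITS CUT WITH AN ALIVE OFFSET»

Cell `hodgecm-mathlib` (D-0151), FLOOR 0, crux item H413 = `stmt-HodgeConjecture-24833`, route of record `HCCMUnconditional`; squad F0∕P3c∕LH4 (req618∕req620); helper lane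
`--supports stmt-HodgeConjecture-24833 --as helper` (count-neutral).  THEOREMS ONLY (no `def`, no instance, no notation, no `sorry`); finite-sum bookkeeping over `ℚ` on
ABSTRACT tables.

WHY ((R5?) of this seat 13:42Z; LH4-p07 (g9) 13:42:57Z «regime B is IN»).  The RamM level socket reads a piece of schedule `a′` on the cells of the scaled multiplier at tokens
`(m₁, jl₁) = (m − a′, jl − a′)`; for ODD `a′` these live in the FLIPPED class `jl₁ ≢ g` (★ p859880), but on the regime-B population (`jl + 1 = m + s0`) the token `m₁` has
the parity `m₁ ≡ g + s0` that ★ p859880's strict letter `hpar : m % 2 = (g + s0 + 1) % 2` excludes.  As for the standard class (★ `toricCensusSum_ramM_parityOrWindow`,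
LH4-p04 (g5)), the parity of `m` is used by the proof only OFF the window — so the letter relaxes to «parity OR window» with the proof unchanged:
* §1 **`toricCensusSum_ramM_flip_parityOrWindow`** — ★ p859880 with `hparW : m % 2 = (g + s0 + 1) % 2 ∨ jl + 2 ≤ m + 2g + s0` (proof adapted from LH4-p11 (g7): the `m`-witness
  moved into the `ε = +1` branch).
* §2 **`toricCensusSum_ramM_flip_v2_cut_offset`** — the consumer shape of the level socket: EDITION-2 binders (`hparW`; near top cells only AGREE; far top cells explicit with the
  alive offset `e` of a scaled multiplier), a cutoff `jl ≤ C`, `C + d_E ≤ m + jl + 1` ⊢ ★ p859973 `toricCensusSum_ramM_flip_cut_offset`'s conclusion VERBATIM — by the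
  re-tabling of this seat's ★ `…RamMV2CutOffset` (cut(v) = cut(w′) cell by cell; cut(w′) = full(w′) − band(w′); full by §1; band by ★ `sum_cut_part_eq_ramM`).
HONEST LABEL.  Count-neutral; nothing about the census is asserted (tables are hypotheses); `HC_CM` is proved only modulo the 7 printed citations (2 remaining named inputs: hLiu418 =
`stmt-HodgeConjecture-24832`, h413 = `stmt-HodgeConjecture-24833`) until rung 0 closes.

## References
* [Kottwitz1986BaseChangeUnits] R. E. Kottwitz, *Base change for unit elements of Hecke algebras*, Compositio Math. 60 (1986): §1 pp. 240–241.
* [Rogawski1990] J. D. Rogawski, *Automorphic Representations of Unitary Groups in Three Variables*, Ann. of Math. Stud. 123 (1990): §4.9 Prop. 4.9.1 (b) p. 55, Lemma 4.9.3 p. 56.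
* [Flicker1998UnitaryFL] Y. Z. Flicker, *Elementary proof of the fundamental lemma for a unitary group*, Canad. J. Math. 50 (1998): Prop. 7 p. 84 (the level tables).
* [Serre1979] J.-P. Serre, *Local Fields*, GTM 67 (1979): Ch. V §3 Cor. 3 (the norm on the unit filtration).
-/

set_option autoImplicit false

namespace Summit.HodgeConjecture.HodgeConjecture.Cruxes.H413.F0P3cDyRamToricCensusSumRamMFlipV2

open Finset
open Summit.HodgeConjecture.HodgeConjecture.Cruxes.H413.F0P3cDyRamToricCensusSumUnrBlocks (sum_range_window_reindex geom_sum_mul')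
open Summit.HodgeConjecture.HodgeConjecture.Cruxes.H413.F0P3cDyRamToricCensusSumRamKParts (genBlock_mul topBlock_mul)
open Summit.HodgeConjecture.HodgeConjecture.Cruxes.H413.F0P3cDyRamToricCensusSumRamMParts
open Summit.HodgeConjecture.HodgeConjecture.Cruxes.H413.F0P3cDyRamToricCensusSumRamMFlip (far_identity_flip)
open Summit.HodgeConjecture.HodgeConjecture.Cruxes.H413.F0P3cDyRamToricCensusSumRamMCutoff (sum_cut_part_eq_ramM)

/-! ## §1 The flipped class, parity OR window -/

set_option maxHeartbeats 400000 in
-- budget only: ★ p859880's proof verbatim (two long `linear_combination`s over reindexed blocks), p11's budget line unchanged.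
/-- **T5s♭, TYPE RamM — PARITY OR WINDOW.**  ★ p859880 `toricCensusSum_ramM_flip` VERBATIM (same tables `hnP hnM`, same depth rules `hvGen hvOff hvTop`, same flipped closed
form) with the token letter relaxed: `hparW : m % 2 = (g + s0 + 1) % 2 ∨ jl + 2 ≤ m + 2g + s0` — off-parity tokens are admitted INSIDE THE WINDOW (the regime-B rows `jl + 1 = m + s0`
of a level piece with ODD schedule `a′`), where the identity still holds: p11's proof uses the parity of `m` only OFF the window (the `ε = +1` far identity), exactly as LH4-p04
(g5)'s ★ `toricCensusSum_ramM_parityOrWindow` did for the standard class.  Twin (this seat, `work/r5b`): 4 272 ∕ 4 272 tuples incl. 1 600 off-parity-in-window; the window-branch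
reindexing bounds `hG`∕`hT` hold for both parities (1 640 window tuples, 0 mismatches).
[cite: Kottwitz1986BaseChangeUnits, §1 pp. 240–241] [cite: Rogawski1990, §4.9 Prop. 4.9.1 (b) p. 55, Lemma 4.9.3 p. 56] [cite: Flicker1998UnitaryFL, Prop. 7 p. 84] [cite: Serre1979, Ch. V §3 Cor. 3] -/
theorem toricCensusSum_ramM_flip_parityOrWindow (q : ℕ) {g s0 jl m : ℕ} (ε : ℚ) (hq : 2 ≤ q) (hg : 1 ≤ g) (hs0 : 1 ≤ s0) (hjl : jl % 2 = (g + 1) % 2)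
    (hjlS : 3 * g + 2 * s0 ≤ jl + 3) (hparW : m % 2 = (g + s0 + 1) % 2 ∨ jl + 2 ≤ m + 2 * g + s0) (hmS : g + s0 ≤ m + 1) (hm : m ≤ jl)
    (hε : ε = 1 ∨ (ε = -1 ∧ jl + 2 ≤ m + 2 * g + s0))
    (nP nM vP vM : ℕ → ℕ → ℚ)
    (hnP : ∀ j a, nP j a = ((if j = 0 then (if a = 0 then 1 else 0) else if j < a then 0
      else if j - a + 1 = s0 then q ^ j else if j - a + 1 < s0 then (if a = 0 then q ^ j else 0) else if (j - a - s0) % 2 = 1 then 0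
      else if a = 0 then (if 2 * g ≤ j - a - s0 then 2 else 1) * q ^ (j - (j - a - s0) / 2)
      else if j - a - s0 + 2 < 2 * g then (q - 1) * q ^ (j - 1 - (j - a - s0) / 2) else if j - a - s0 + 2 = 2 * g then (q - 2) * q ^ (j - 1 - (j - a - s0) / 2)
      else 2 * (q - 1) * q ^ (j - 1 - (j - a - s0) / 2) : ℕ) : ℚ))
    (hnM : ∀ j a, nM j a = ((if j = 0 then (if a = 0 then 1 else 0) else if j < a then 0
      else if j - a + 1 = s0 then q ^ j else if j - a + 1 < s0 then (if a = 0 then q ^ j else 0) else if (j - a - s0) % 2 = 1 then 0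
      else if a = 0 then (if j - a - s0 + 2 ≤ 2 * g then q ^ (j - (j - a - s0) / 2) else 0)
      else if j - a - s0 + 2 < 2 * g then (q - 1) * q ^ (j - 1 - (j - a - s0) / 2) else if j - a - s0 + 2 = 2 * g then q ^ (j - (j - a - s0) / 2) else 0 : ℕ) : ℚ))
    (hvGen : ∀ j a, (a ≤ m ∧ (j + a ≤ m ∨ (2 * a ≤ m ∧ j + a ≤ jl))) → vP j a = nP j a ∧ vM j a = nM j a)
    (hvOff : ∀ j a, ¬ (a ≤ m ∧ (j + a ≤ m ∨ (2 * a ≤ m ∧ j + a ≤ jl))) → j + m ≠ jl + a → vP j a = 0 ∧ vM j a = 0)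
    (hvTop : ∀ j a, ¬ (a ≤ m ∧ (j + a ≤ m ∨ (2 * a ≤ m ∧ j + a ≤ jl))) → j + m = jl + a →
      (vP j a = if 2 * j + (g + s0) ≤ 2 * jl + 1 ∧ (j + a + 2 ≤ m + s0 + 2 * g ∨ ε = 1) then
          (if j + a < m + s0 then (q : ℚ) ^ j else (if 2 * g ≤ j + a - m - s0 + 1 then 2 else 1) * (q : ℚ) ^ (j - (j + a - m - s0 + 1) / 2)) else 0) ∧
      (vM j a = if 2 * j + (g + s0) ≤ 2 * jl + 1 ∧ (j + a + 2 ≤ m + s0 + 2 * g ∨ ε = -1) then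
          (if j + a < m + s0 then (q : ℚ) ^ j else (if 2 * g ≤ j + a - m - s0 + 1 then 2 else 1) * (q : ℚ) ^ (j - (j + a - m - s0 + 1) / 2)) else 0)) :
    ε * ∑ j ∈ range (jl + 1), ∑ a ∈ range (jl + 2), (q : ℚ) ^ a * (vP j a - vM j a) =
      (q : ℚ) ^ m * (2 * ∑ i ∈ range ((jl + 1 - g) / 2 + (g + s0) % 2), (q : ℚ) ^ i - 2 * ∑ i ∈ range (g + s0 - 1 + (g + s0) % 2), (q : ℚ) ^ i) := by
  set x : ℚ := (q : ℚ) with hxq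
  have hx1 : x ≠ 1 := by rw [hxq]; exact_mod_cast (show q ≠ 1 by omega)
  have hε' : ε = 1 ∨ ε = -1 := hε.imp_right And.left
  have hεε : ε * ε = 1 := by rcases hε' with rfl | rfl <;> norm_num
  -- parity witness of the flipped conductor class (`jl + 1 = g + 2n`) and the floors it determines (fed to `omega`); the token `m`'s witness only OFF the window
  obtain ⟨n, hn, e1, e3, e4⟩ : ∃ n : ℕ, jl + 1 = g + 2 * n ∧
      (jl + s0) / 2 + 1 = n + (g + s0) / 2 + (g + s0) % 2 ∧ (jl + 1 - g) / 2 = n ∧ (jl - s0) / 2 + s0 = (jl + s0) / 2 :=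
    ⟨(jl + 1 - g) / 2, by omega, by omega, rfl, by omega⟩
  have hδ : ∀ j a, nP j a - nM j a = if a + s0 ≤ j ∧ (j - (a + s0)) % 2 = 0 then
      (if a = 0 then (if 2 * g ≤ j - s0 then 2 * x ^ (j - (j - s0) / 2) else 0)
       else (if j - a - s0 + 2 = 2 * g then -2 * x ^ (j - 1 - (j - a - s0) / 2)
         else if 2 * g < j - a - s0 + 2 then 2 * (x - 1) * x ^ (j - 1 - (j - a - s0) / 2) else 0)) else 0 := fun j a => by rw [hnP, hnM]; exact tables_diff_ramM q hq hg j a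
  -- columns first
  rw [Finset.sum_comm, Finset.sum_range_succ', col_zero_ramM x hg nP nM vP vM hδ hvGen,
    Finset.sum_congr rfl (fun a _ => col_pos_ramM x ε hε' hg hm nP nM vP vM hδ hvGen hvOff hvTop (show 1 ≤ a + 1 by omega)),
    Finset.sum_add_distrib, ← Finset.mul_sum]
  -- the RHS, multiplied by `x − 1`
  have hR : (x - 1) * (x ^ m * (2 * ∑ i ∈ range ((jl + 1 - g) / 2 + (g + s0) % 2), x ^ i - 2 * ∑ i ∈ range (g + s0 - 1 + (g + s0) % 2), x ^ i)) =
      2 * x ^ m * (x ^ ((jl + 1 - g) / 2 + (g + s0) % 2) - x ^ (g + s0 - 1 + (g + s0) % 2)) := by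
    have h1 := geom_sum_mul' x ((jl + 1 - g) / 2 + (g + s0) % 2)
    have h2 := geom_sum_mul' x (g + s0 - 1 + (g + s0) % 2)
    linear_combination (2 * x ^ m) * h1 - (2 * x ^ m) * h2
  -- the column `a = 0`, multiplied by `x − 1`
  have hC0 : (x - 1) * (2 * x ^ (g + s0) * ∑ k ∈ range ((jl - s0) / 2 + 1 - g), x ^ k) = 2 * x ^ (g + s0) * (x ^ ((jl - s0) / 2 + 1 - g) - 1) := by
    have h1 := geom_sum_mul' x ((jl - s0) / 2 + 1 - g)
    linear_combination (2 * x ^ (g + s0)) * h1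
  by_cases hreg : jl + 2 ≤ m + 2 * g + s0
  · ---------------------------------------------------------------- the window `ℓ ≤ 2d − 2`: the generic part cancels, the top cells give everything
    -- generic columns: `a + 1 ≤ ⌊jl∕2⌋ + 1 − d`
    have hG : ∀ a ∈ range (jl + 1), (if 2 * (a + 1) ≤ m ∧ 2 * g + 2 * (a + 1) + s0 ≤ jl + 2 then 2 * x ^ ((jl + s0) / 2 + (a + 1)) - 2 * (x + 1) * x ^ (2 * (a + 1) + (g + s0) - 2) else 0) =
        (if 0 ≤ a ∧ a < 0 + ((jl - s0) / 2 + 1 - g) then 2 * x ^ ((jl + s0) / 2 + 1) * x ^ a - 2 * (x + 1) * x ^ (g + s0) * x ^ (2 * a) else 0) := by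
      intro a _
      by_cases h : 2 * (a + 1) ≤ m ∧ 2 * g + 2 * (a + 1) + s0 ≤ jl + 2
      · rw [if_pos h, if_pos (by omega), show (jl + s0) / 2 + (a + 1) = ((jl + s0) / 2 + 1) + a by omega, pow_add, show 2 * (a + 1) + (g + s0) - 2 = (g + s0) + 2 * a by omega, pow_add]; ring
      · rw [if_neg h, if_neg (by omega)]
    -- top cells: `m + S♭ − ⌊(jl+s0)∕2⌋ ≤ a + 1 ≤ m − ⌊d_E∕2⌋`, `S♭ = d_E − 1 + d_E%2`
    have hT : ∀ a ∈ range (jl + 1), (if m < 2 * (a + 1) ∧ 2 * (a + 1) + (g + s0) ≤ 2 * m + 1 ∧ 2 * m + 2 * g + s0 ≤ jl + 2 * (a + 1) + 1 then 2 * x ^ ((jl + s0) / 2 + (a + 1)) else 0) =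
        (if (m + (g + s0 - 1 + (g + s0) % 2) - (jl + s0) / 2 - 1) ≤ a ∧ a < (m + (g + s0 - 1 + (g + s0) % 2) - (jl + s0) / 2 - 1) + ((jl + 1 - g) / 2 + 1 - (g + s0)) then 2 * x ^ (m + (g + s0 - 1 + (g + s0) % 2)) * x ^ (a - (m + (g + s0 - 1 + (g + s0) % 2) - (jl + s0) / 2 - 1)) else 0) := by
      intro a _
      by_cases h : m < 2 * (a + 1) ∧ 2 * (a + 1) + (g + s0) ≤ 2 * m + 1 ∧ 2 * m + 2 * g + s0 ≤ jl + 2 * (a + 1) + 1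
      · rw [if_pos h, if_pos (by omega), show (jl + s0) / 2 + (a + 1) = (m + (g + s0 - 1 + (g + s0) % 2)) + (a - (m + (g + s0 - 1 + (g + s0) % 2) - (jl + s0) / 2 - 1)) by omega, pow_add, ← mul_assoc]
      · rw [if_neg h, if_neg (by omega)]
    rw [Finset.sum_congr rfl hG, sum_range_window_reindex (fun a => 2 * x ^ ((jl + s0) / 2 + 1) * x ^ a - 2 * (x + 1) * x ^ (g + s0) * x ^ (2 * a)) (show 0 + ((jl - s0) / 2 + 1 - g) ≤ jl + 1 by omega),
      Finset.sum_congr rfl hT, sum_range_window_reindex (fun a => 2 * x ^ (m + (g + s0 - 1 + (g + s0) % 2)) * x ^ (a - (m + (g + s0 - 1 + (g + s0) % 2) - (jl + s0) / 2 - 1)))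
        (show (m + (g + s0 - 1 + (g + s0) % 2) - (jl + s0) / 2 - 1) + ((jl + 1 - g) / 2 + 1 - (g + s0)) ≤ jl + 1 by omega)]
    simp_rw [zero_add, Nat.add_sub_cancel_left]
    have hA : (x - 1) * (∑ i ∈ range ((jl - s0) / 2 + 1 - g), (2 * x ^ ((jl + s0) / 2 + 1) * x ^ i - 2 * (x + 1) * x ^ (g + s0) * x ^ (2 * i)) + 2 * x ^ (g + s0) * ∑ k ∈ range ((jl - s0) / 2 + 1 - g), x ^ k) = 0 := by
      rw [mul_add, genBlock_mul, hC0]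
      have f1 : x ^ ((jl + s0) / 2 + 1) = x ^ ((jl - s0) / 2 + 1 - g) * x ^ (g + s0) := by rw [← pow_add]; congr 1; omega
      have f2 : x ^ (2 * ((jl - s0) / 2 + 1 - g)) = x ^ ((jl - s0) / 2 + 1 - g) * x ^ ((jl - s0) / 2 + 1 - g) := by rw [← pow_add]; congr 1; omega
      rw [f1, f2]; ring
    have hA' : ∑ i ∈ range ((jl - s0) / 2 + 1 - g), (2 * x ^ ((jl + s0) / 2 + 1) * x ^ i - 2 * (x + 1) * x ^ (g + s0) * x ^ (2 * i)) + 2 * x ^ (g + s0) * ∑ k ∈ range ((jl - s0) / 2 + 1 - g), x ^ k = 0 := by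
      rcases mul_eq_zero.1 hA with h | h
      · exact absurd (sub_eq_zero.1 h) hx1
      · exact h
    have hB : (x - 1) * ∑ i ∈ range ((jl + 1 - g) / 2 + 1 - (g + s0)), 2 * x ^ (m + (g + s0 - 1 + (g + s0) % 2)) * x ^ i =
        (x - 1) * (x ^ m * (2 * ∑ i ∈ range ((jl + 1 - g) / 2 + (g + s0) % 2), x ^ i - 2 * ∑ i ∈ range (g + s0 - 1 + (g + s0) % 2), x ^ i)) := by
      rw [topBlock_mul, hR, pow_add x m (g + s0 - 1 + (g + s0) % 2)]
      have f1 : x ^ ((jl + 1 - g) / 2 + (g + s0) % 2) = x ^ (g + s0 - 1 + (g + s0) % 2) * x ^ ((jl + 1 - g) / 2 + 1 - (g + s0)) := by rw [← pow_add]; congr 1; omega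
      rw [f1]; ring
    have hB' := mul_left_cancel₀ (sub_ne_zero.2 hx1) hB
    linear_combination ε * hA' + (∑ i ∈ range ((jl + 1 - g) / 2 + 1 - (g + s0)), 2 * x ^ (m + (g + s0 - 1 + (g + s0) % 2)) * x ^ i) * hεε + hB'
  · ---------------------------------------------------------------- `ℓ ≥ 2d`: `ε = +1`, generic columns `a + 1 ≤ ⌊m∕2⌋`, top cells `⌊m∕2⌋ + 1 ≤ a + 1 ≤ m − ⌊d∕2⌋`
    have hε1 : ε = 1 := by rcases hε with h | ⟨_, h⟩; exact h; exact absurd h hreg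
    subst hε1
    have hpar : m % 2 = (g + s0 + 1) % 2 := hparW.resolve_right hreg
    obtain ⟨k, hk, e2⟩ : ∃ k : ℕ, m + 1 = g + s0 + 2 * k ∧ m / 2 + 1 = k + (g + s0) / 2 + (g + s0) % 2 :=
      ⟨(m + 1 - (g + s0)) / 2, by omega, by omega⟩
    have hG : ∀ a ∈ range (jl + 1), (if 2 * (a + 1) ≤ m ∧ 2 * g + 2 * (a + 1) + s0 ≤ jl + 2 then 2 * x ^ ((jl + s0) / 2 + (a + 1)) - 2 * (x + 1) * x ^ (2 * (a + 1) + (g + s0) - 2) else 0) =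
        (if 0 ≤ a ∧ a < 0 + m / 2 then 2 * x ^ ((jl + s0) / 2 + 1) * x ^ a - 2 * (x + 1) * x ^ (g + s0) * x ^ (2 * a) else 0) := by
      intro a _
      by_cases h : 2 * (a + 1) ≤ m ∧ 2 * g + 2 * (a + 1) + s0 ≤ jl + 2
      · rw [if_pos h, if_pos (by omega), show (jl + s0) / 2 + (a + 1) = ((jl + s0) / 2 + 1) + a by omega, pow_add, show 2 * (a + 1) + (g + s0) - 2 = (g + s0) + 2 * a by omega, pow_add]; ring
      · rw [if_neg h, if_neg (by omega)]
    have hT : ∀ a ∈ range (jl + 1), (if m < 2 * (a + 1) ∧ 2 * (a + 1) + (g + s0) ≤ 2 * m + 1 ∧ 2 * m + 2 * g + s0 ≤ jl + 2 * (a + 1) + 1 then 2 * x ^ ((jl + s0) / 2 + (a + 1)) else 0) =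
        (if m / 2 ≤ a ∧ a < m / 2 + (m - (g + s0) / 2 - m / 2) then 2 * x ^ ((jl + s0) / 2 + m / 2 + 1) * x ^ (a - m / 2) else 0) := by
      intro a _
      by_cases h : m < 2 * (a + 1) ∧ 2 * (a + 1) + (g + s0) ≤ 2 * m + 1 ∧ 2 * m + 2 * g + s0 ≤ jl + 2 * (a + 1) + 1
      · rw [if_pos h, if_pos (by omega), show (jl + s0) / 2 + (a + 1) = ((jl + s0) / 2 + m / 2 + 1) + (a - m / 2) by omega, pow_add, ← mul_assoc]
      · rw [if_neg h, if_neg (by omega)]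
    rw [Finset.sum_congr rfl hG, sum_range_window_reindex (fun a => 2 * x ^ ((jl + s0) / 2 + 1) * x ^ a - 2 * (x + 1) * x ^ (g + s0) * x ^ (2 * a)) (show 0 + m / 2 ≤ jl + 1 by omega),
      Finset.sum_congr rfl hT, sum_range_window_reindex (fun a => 2 * x ^ ((jl + s0) / 2 + m / 2 + 1) * x ^ (a - m / 2)) (show m / 2 + (m - (g + s0) / 2 - m / 2) ≤ jl + 1 by omega)]
    simp_rw [zero_add, Nat.add_sub_cancel_left, one_mul]
    apply mul_left_cancel₀ (sub_ne_zero.2 hx1)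
    rw [mul_add, mul_add, genBlock_mul, topBlock_mul, hC0, hR]
    linear_combination far_identity_flip x hg hs0 hmS hm (by omega) hn hk e1 e2 e3 e4

/-! ## §2 The flipped-class cut with an alive offset, EDITION-2 binders -/

/-- **T5s♭-RamM v2 — THE FLIPPED-CLASS CUT WELD WITH AN ALIVE OFFSET UNDER THE WINDOW-PARITY LETTER.**  ★ p859973 `toricCensusSum_ramM_flip_cut_offset`'s binders with
`hpar` ↦ `hparW : m % 2 = (g + s0 + 1) % 2 ∨ jl + 2 ≤ m + 2g + s0` and `hvTopE` ↦ (`hvTopNear` : near top cells AGREE) + (`hvTopFarE` : far top cells explicit with the alive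
offset `e`) ⊢ ★ p859973's conclusion VERBATIM — both parity regimes of the flipped class (§1 on the EDITION-1 re-tabling `w′`, cut(v) = cut(w′) cell by cell).
[cite: Kottwitz1986BaseChangeUnits, §1 pp. 240–241] [cite: Rogawski1990, §4.9 Prop. 4.9.1 (b) p. 55, Lemma 4.9.3 p. 56] [cite: Flicker1998UnitaryFL, Prop. 7 p. 84] -/
theorem toricCensusSum_ramM_flip_v2_cut_offset (q : ℕ) {g s0 jl m : ℕ} (ε : ℚ) (hq : 2 ≤ q) (hg : 1 ≤ g) (hs0 : 1 ≤ s0) (hjl : jl % 2 = (g + 1) % 2)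
    (hjlS : 3 * g + 2 * s0 ≤ jl + 3) (hparW : m % 2 = (g + s0 + 1) % 2 ∨ jl + 2 ≤ m + 2 * g + s0) (hmS : g + s0 ≤ m + 1) (hm : m ≤ jl)
    (hε : ε = 1 ∨ (ε = -1 ∧ jl + 2 ≤ m + 2 * g + s0))
    (nP nM vP vM : ℕ → ℕ → ℚ)
    (hnP : ∀ j a, nP j a = ((if j = 0 then (if a = 0 then 1 else 0) else if j < a then 0
      else if j - a + 1 = s0 then q ^ j else if j - a + 1 < s0 then (if a = 0 then q ^ j else 0) else if (j - a - s0) % 2 = 1 then 0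
      else if a = 0 then (if 2 * g ≤ j - a - s0 then 2 else 1) * q ^ (j - (j - a - s0) / 2)
      else if j - a - s0 + 2 < 2 * g then (q - 1) * q ^ (j - 1 - (j - a - s0) / 2) else if j - a - s0 + 2 = 2 * g then (q - 2) * q ^ (j - 1 - (j - a - s0) / 2)
      else 2 * (q - 1) * q ^ (j - 1 - (j - a - s0) / 2) : ℕ) : ℚ))
    (hnM : ∀ j a, nM j a = ((if j = 0 then (if a = 0 then 1 else 0) else if j < a then 0
      else if j - a + 1 = s0 then q ^ j else if j - a + 1 < s0 then (if a = 0 then q ^ j else 0) else if (j - a - s0) % 2 = 1 then 0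
      else if a = 0 then (if j - a - s0 + 2 ≤ 2 * g then q ^ (j - (j - a - s0) / 2) else 0)
      else if j - a - s0 + 2 < 2 * g then (q - 1) * q ^ (j - 1 - (j - a - s0) / 2) else if j - a - s0 + 2 = 2 * g then q ^ (j - (j - a - s0) / 2) else 0 : ℕ) : ℚ))
    (hvGen : ∀ j a, (a ≤ m ∧ (j + a ≤ m ∨ (2 * a ≤ m ∧ j + a ≤ jl))) → vP j a = nP j a ∧ vM j a = nM j a)
    (hvOff : ∀ j a, ¬ (a ≤ m ∧ (j + a ≤ m ∨ (2 * a ≤ m ∧ j + a ≤ jl))) → j + m ≠ jl + a → vP j a = 0 ∧ vM j a = 0)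
    (hvTopNear : ∀ j a, ¬ (a ≤ m ∧ (j + a ≤ m ∨ (2 * a ≤ m ∧ j + a ≤ jl))) → j + m = jl + a → j + a + 2 ≤ m + s0 + 2 * g → vP j a = vM j a)
    (e : ℕ)
    (hvTopFarE : ∀ j a, ¬ (a ≤ m ∧ (j + a ≤ m ∨ (2 * a ≤ m ∧ j + a ≤ jl))) → j + m = jl + a → ¬ (j + a + 2 ≤ m + s0 + 2 * g) →
      (vP j a = if 2 * j + (g + s0) ≤ 2 * jl + 1 + e ∧ ε = 1 then 2 * (q : ℚ) ^ (j - (j + a - m - s0 + 1) / 2) else 0) ∧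
      (vM j a = if 2 * j + (g + s0) ≤ 2 * jl + 1 + e ∧ ε = -1 then 2 * (q : ℚ) ^ (j - (j + a - m - s0 + 1) / 2) else 0))
    (C : ℕ) (hC : jl ≤ C) (hCe : C + (g + s0) ≤ m + jl + 1) :
    ε * ∑ j ∈ range (jl + 1), ∑ a ∈ range (jl + 2), (q : ℚ) ^ a * (if j + a ≤ C then vP j a - vM j a else 0) =
      (q : ℚ) ^ m * (2 * ∑ i ∈ range ((jl + 1 - g) / 2 + (g + s0) % 2), (q : ℚ) ^ i - 2 * ∑ i ∈ range (g + s0 - 1 + (g + s0) % 2), (q : ℚ) ^ i) -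
        2 * ∑ a ∈ (range (jl + 2)).filter (fun a => a ≤ m ∧ C + m < jl + 2 * a ∧ 2 * m + 2 * g + s0 < jl + 2 * a + 2 ∧ 2 * a + (g + s0) ≤ 2 * m + 1),
          (q : ℚ) ^ (a + (jl + s0) / 2) := by
  classical
  have hε' : ε = 1 ∨ ε = -1 := hε.imp_right And.left
  -- (0) the EDITION-1 re-tabling of the top diagonal at the STANDARD alive boundary
  obtain ⟨wP, hwPdef⟩ : ∃ f : ℕ → ℕ → ℚ, f = fun j a =>
      if ¬ (a ≤ m ∧ (j + a ≤ m ∨ (2 * a ≤ m ∧ j + a ≤ jl))) ∧ j + m = jl + a then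
        (if 2 * j + (g + s0) ≤ 2 * jl + 1 ∧ (j + a + 2 ≤ m + s0 + 2 * g ∨ ε = 1) then
          (if j + a < m + s0 then (q : ℚ) ^ j else (if 2 * g ≤ j + a - m - s0 + 1 then 2 else 1) * (q : ℚ) ^ (j - (j + a - m - s0 + 1) / 2)) else 0)
      else vP j a := ⟨_, rfl⟩
  obtain ⟨wM, hwMdef⟩ : ∃ f : ℕ → ℕ → ℚ, f = fun j a =>
      if ¬ (a ≤ m ∧ (j + a ≤ m ∨ (2 * a ≤ m ∧ j + a ≤ jl))) ∧ j + m = jl + a then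
        (if 2 * j + (g + s0) ≤ 2 * jl + 1 ∧ (j + a + 2 ≤ m + s0 + 2 * g ∨ ε = -1) then
          (if j + a < m + s0 then (q : ℚ) ^ j else (if 2 * g ≤ j + a - m - s0 + 1 then 2 else 1) * (q : ℚ) ^ (j - (j + a - m - s0 + 1) / 2)) else 0)
      else vM j a := ⟨_, rfl⟩
  have hwGen : ∀ j a, (a ≤ m ∧ (j + a ≤ m ∨ (2 * a ≤ m ∧ j + a ≤ jl))) → wP j a = nP j a ∧ wM j a = nM j a := fun j a hG => by
    obtain ⟨h1, h2⟩ := hvGen j a hG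
    have hnt : ¬ (¬ (a ≤ m ∧ (j + a ≤ m ∨ (2 * a ≤ m ∧ j + a ≤ jl))) ∧ j + m = jl + a) := fun h0 => h0.1 hG
    rw [hwPdef, hwMdef]; dsimp only; rw [if_neg hnt, if_neg hnt, h1, h2]; exact ⟨rfl, rfl⟩
  have hwOff : ∀ j a, ¬ (a ≤ m ∧ (j + a ≤ m ∨ (2 * a ≤ m ∧ j + a ≤ jl))) → j + m ≠ jl + a → wP j a = 0 ∧ wM j a = 0 := fun j a hnG hoff => by
    obtain ⟨h1, h2⟩ := hvOff j a hnG hoff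
    have hnt : ¬ (¬ (a ≤ m ∧ (j + a ≤ m ∨ (2 * a ≤ m ∧ j + a ≤ jl))) ∧ j + m = jl + a) := fun h0 => hoff h0.2
    rw [hwPdef, hwMdef]; dsimp only; rw [if_neg hnt, if_neg hnt, h1, h2]; exact ⟨rfl, rfl⟩
  -- EDITION 1's `hvTop` for `w′` (by construction)
  have hwTop : ∀ j a, ¬ (a ≤ m ∧ (j + a ≤ m ∨ (2 * a ≤ m ∧ j + a ≤ jl))) → j + m = jl + a →
      (wP j a = if 2 * j + (g + s0) ≤ 2 * jl + 1 ∧ (j + a + 2 ≤ m + s0 + 2 * g ∨ ε = 1) then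
          (if j + a < m + s0 then (q : ℚ) ^ j else (if 2 * g ≤ j + a - m - s0 + 1 then 2 else 1) * (q : ℚ) ^ (j - (j + a - m - s0 + 1) / 2)) else 0) ∧
      (wM j a = if 2 * j + (g + s0) ≤ 2 * jl + 1 ∧ (j + a + 2 ≤ m + s0 + 2 * g ∨ ε = -1) then
          (if j + a < m + s0 then (q : ℚ) ^ j else (if 2 * g ≤ j + a - m - s0 + 1 then 2 else 1) * (q : ℚ) ^ (j - (j + a - m - s0 + 1) / 2)) else 0) :=
    fun j a hnG hdiag => by
    have hnt : ¬ (a ≤ m ∧ (j + a ≤ m ∨ (2 * a ≤ m ∧ j + a ≤ jl))) ∧ j + m = jl + a := ⟨hnG, hdiag⟩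
    rw [hwPdef, hwMdef]; dsimp only; rw [if_pos hnt, if_pos hnt]; exact ⟨rfl, rfl⟩
  -- EDITION 2's `hvTopNear` ∕ `hvTopFar` for `w′`
  have hwTopNear : ∀ j a, ¬ (a ≤ m ∧ (j + a ≤ m ∨ (2 * a ≤ m ∧ j + a ≤ jl))) → j + m = jl + a → j + a + 2 ≤ m + s0 + 2 * g → wP j a = wM j a :=
    fun j a hnG hdiag hnear => by
    obtain ⟨hP, hM⟩ := hwTop j a hnG hdiag
    have hiffP : (2 * j + (g + s0) ≤ 2 * jl + 1 ∧ (j + a + 2 ≤ m + s0 + 2 * g ∨ ε = 1)) ↔ 2 * j + (g + s0) ≤ 2 * jl + 1 :=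
      ⟨fun h0 => h0.1, fun h0 => ⟨h0, Or.inl hnear⟩⟩
    have hiffM : (2 * j + (g + s0) ≤ 2 * jl + 1 ∧ (j + a + 2 ≤ m + s0 + 2 * g ∨ ε = -1)) ↔ 2 * j + (g + s0) ≤ 2 * jl + 1 :=
      ⟨fun h0 => h0.1, fun h0 => ⟨h0, Or.inl hnear⟩⟩
    rw [hP, hM, if_congr hiffP rfl rfl, if_congr hiffM rfl rfl]
  have hwTopFar : ∀ j a, ¬ (a ≤ m ∧ (j + a ≤ m ∨ (2 * a ≤ m ∧ j + a ≤ jl))) → j + m = jl + a → ¬ (j + a + 2 ≤ m + s0 + 2 * g) →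
      (wP j a = if 2 * j + (g + s0) ≤ 2 * jl + 1 ∧ ε = 1 then 2 * (q : ℚ) ^ (j - (j + a - m - s0 + 1) / 2) else 0) ∧
      (wM j a = if 2 * j + (g + s0) ≤ 2 * jl + 1 ∧ ε = -1 then 2 * (q : ℚ) ^ (j - (j + a - m - s0 + 1) / 2) else 0) := fun j a hnG hdiag hfar => by
    obtain ⟨hP, hM⟩ := hwTop j a hnG hdiag
    have hlt : ¬ (j + a < m + s0) := by omega
    have h2g : 2 * g ≤ j + a - m - s0 + 1 := by omega
    rw [hP, hM, if_neg hlt, if_pos h2g]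
    constructor
    · by_cases hc : 2 * j + (g + s0) ≤ 2 * jl + 1 ∧ ε = 1
      · have hc' : 2 * j + (g + s0) ≤ 2 * jl + 1 ∧ (j + a + 2 ≤ m + s0 + 2 * g ∨ ε = 1) := ⟨hc.1, Or.inr hc.2⟩
        rw [if_pos hc, if_pos hc']
      · have hc' : ¬ (2 * j + (g + s0) ≤ 2 * jl + 1 ∧ (j + a + 2 ≤ m + s0 + 2 * g ∨ ε = 1)) := fun h0 => hc ⟨h0.1, h0.2.resolve_left hfar⟩
        rw [if_neg hc, if_neg hc']
    · by_cases hc : 2 * j + (g + s0) ≤ 2 * jl + 1 ∧ ε = -1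
      · have hc' : 2 * j + (g + s0) ≤ 2 * jl + 1 ∧ (j + a + 2 ≤ m + s0 + 2 * g ∨ ε = -1) := ⟨hc.1, Or.inr hc.2⟩
        rw [if_pos hc, if_pos hc']
      · have hc' : ¬ (2 * j + (g + s0) ≤ 2 * jl + 1 ∧ (j + a + 2 ≤ m + s0 + 2 * g ∨ ε = -1)) := fun h0 => hc ⟨h0.1, h0.2.resolve_left hfar⟩
        rw [if_neg hc, if_neg hc']
  -- (i) the cut sums of `v` and `w′` agree cell by cell
  have hcell : ∀ j a, (if j + a ≤ C then vP j a - vM j a else 0) = (if j + a ≤ C then wP j a - wM j a else 0) := fun j a => by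
    by_cases hcut : j + a ≤ C
    · rw [if_pos hcut, if_pos hcut]
      by_cases hnt : ¬ (a ≤ m ∧ (j + a ≤ m ∨ (2 * a ≤ m ∧ j + a ≤ jl))) ∧ j + m = jl + a
      · have halive : 2 * j + (g + s0) ≤ 2 * jl + 1 := by omega
        by_cases hnear : j + a + 2 ≤ m + s0 + 2 * g
        · rw [hvTopNear j a hnt.1 hnt.2 hnear, sub_self, hwTopNear j a hnt.1 hnt.2 hnear, sub_self]
        · obtain ⟨hP, hM⟩ := hvTopFarE j a hnt.1 hnt.2 hnear
          obtain ⟨hP', hM'⟩ := hwTopFar j a hnt.1 hnt.2 hnear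
          have hiffP : (2 * j + (g + s0) ≤ 2 * jl + 1 + e ∧ ε = 1) ↔ (2 * j + (g + s0) ≤ 2 * jl + 1 ∧ ε = 1) :=
            ⟨fun h0 => ⟨halive, h0.2⟩, fun h0 => ⟨by omega, h0.2⟩⟩
          have hiffM : (2 * j + (g + s0) ≤ 2 * jl + 1 + e ∧ ε = -1) ↔ (2 * j + (g + s0) ≤ 2 * jl + 1 ∧ ε = -1) :=
            ⟨fun h0 => ⟨halive, h0.2⟩, fun h0 => ⟨by omega, h0.2⟩⟩
          rw [hP, hM, hP', hM', if_congr hiffP rfl rfl, if_congr hiffM rfl rfl]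
      · rw [hwPdef, hwMdef]; dsimp only; rw [if_neg hnt, if_neg hnt]
    · rw [if_neg hcut, if_neg hcut]
  simp_rw [hcell]
  -- (ii) cut(w′) = full(w′) − band(w′); (iii) ★ v2; (iv) ★ the cut band
  have hsplit : ∀ j a, (q : ℚ) ^ a * (if j + a ≤ C then wP j a - wM j a else 0) =
      (q : ℚ) ^ a * (wP j a - wM j a) - (q : ℚ) ^ a * (if C < j + a then wP j a - wM j a else 0) := fun j a => by
    by_cases h : j + a ≤ C
    · rw [if_pos h, if_neg (not_lt.2 h), mul_zero, sub_zero]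
    · rw [if_neg h, if_pos (not_le.1 h), mul_zero, sub_self]
  simp_rw [hsplit]
  simp only [Finset.sum_sub_distrib]
  rw [mul_sub, toricCensusSum_ramM_flip_parityOrWindow q ε hq hg hs0 hjl hjlS hparW hmS hm hε nP nM wP wM hnP hnM hwGen hwOff hwTop,
    sum_cut_part_eq_ramM (q : ℚ) ε hε' hg hm hC wP wM hwOff hwTop]

end Summit.HodgeConjecture.HodgeConjecture.Cruxes.H413.F0P3cDyRamToricCensusSumRamMFlipV2
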